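import Summits.AtomisticToContinuum.Crystallization.Theorems.SquareWellLayerCakeGapTwelveToBarlowCombinatorialLayeringTransportSteps1
import Summits.AtomisticToContinuum.Crystallization.Theorems.SquareWellLayerCakeGapTwelveToBarlowCombinatorialLayeringTransportSteps2
import Summits.AtomisticToContinuum.Crystallization.Theorems.SquareWellLayerCakeGapTwelveToBarlowCombinatorialLayeringTransportSteps3
import Summits.AtomisticToContinuum.Crystallization.Theorems.SquareWellLayerCakeGapTwelveToBarlowCombinatorialLayeringTransportSteps4
import Summits.AtomisticToContinuum.Crystallization.Theorems.SquareWellLayerCakeGapTwelveToBarlowCombinatorialLayeringTransportSteps5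

/-!
# Combinatorial layering (B1a of `GapTwelveToBarlow`): transport port, part `Lower`

Crux `SquareWellLayerCake.GapTwelveToBarlow` (stmt-AtomisticToContinuum-15807), line `Sketch`,
stub `stub_combinatorialLayering`, residual `(H_develop)`.  PORT of the tree file
`PalmUnimodularRigidityShellsToBarlowChartTransportLower.lean` (crux 9227) to GRADED COMBINATORIAL
charts, following the port rules recorded in `…CombinatorialLayeringTransportSteps1` (bundled
standing hypothesis `hch` on `S : ℕ → Set E3`, abstract bond relation `B`, memberships
`x ∈ S (n + k)`, transfer as an input).  Statements and proofs are otherwise those of the source,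
whose documentation follows.

# Line `develop-the-model-growth-descent` (crux `ShellsToBarlowChart`, stmt-AtomisticToContinuum-9227): lower caps are carried by the in-layer transports

Helper lemmas for `stub_transportSystem` (the geometric half of the line): frames `⟨x, t₁, t₂, U⟩`
read in the integer charts `IsZChart` of a good-shell configuration, their transports and the
coherence of the resulting development `frameAt`.  The only metric inputs are the chart transfer
lemma and `bond_nb_iff`; everything else is label combinatorics in `ℤ³` (pattern facts
`TransportPatterns*`).  All `[folklore]` (HalesDSP2012 §1.3 for the two kissing patterns).
-/

noncomputable section

namespace Summit.AtomisticToContinuum.Crystallization.Theorems.SquareWellLayerCakeGapTwelveToBarlow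

open Literature.Geometry.DiscreteGeometry Literature.MathematicalPhysics.StatisticalMechanics
open Summit.AtomisticToContinuum.Crystallization.Theorems.PalmUnimodularRigidityShellsToBarlowChart hiding
  IsZChart TransportSystem scales_tied sqNormInt_transfer bond_symm nb_mem zlab_spec zlab_nb
  bond_nb_iff pattern_cases transfer_nb_nb transfer_nb_centre transfer_nb_target
  sqNormInt_zlab_centre hcp_of_mirror_pair Istep_spec Jstep_spec IinvStep_spec JinvStep_spec
  capWithAny_of_mem_cap IinvStep_Istep Istep_IinvStep JinvStep_Jstep Jstep_JinvStep polar_at_apex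
  onesided_at_apex Vstep_spec nb_inj Istep_lower Jstep_lower IinvStep_lower JinvStep_lower
  polar_at_lower_apex onesided_at_lower_apex VinvStep_spec attach_I_even attach_I_odd
  attach_lower_I_pos attach_lower_I_neg attach_J_even attach_J_odd Vstep_Istep_pt Vstep_Istep_back
  Vstep_Istep_side Vstep_Jstep_pt Vstep_Istep_comm Vstep_Jstep_comm attach_lower_J_pos
  attach_lower_J_neg VinvStep_Istep_pt VinvStep_Jstep_pt VinvStep_Istep_back VinvStep_Istep_side
  VinvStep_Istep_comm VinvStep_Jstep_comm Istep_Jstep_comm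

variable {S : ℕ → Set (EuclideanSpace ℝ (Fin 3))}
  {B : EuclideanSpace ℝ (Fin 3) → EuclideanSpace ℝ (Fin 3) → Prop}
  {Pc : EuclideanSpace ℝ (Fin 3) → Finset (Fin 3 → ℤ)}
  {nb : EuclideanSpace ℝ (Fin 3) → (Fin 3 → ℤ) → EuclideanSpace ℝ (Fin 3)}

variable
  (hch : (∀ n : ℕ, ∀ z ∈ S n, (Pc z = fcc3Int ∨ Pc z = hcpInt) ∧
      Set.BijOn (nb z) (↑(Pc z) : Set (Fin 3 → ℤ)) {y | B z y} ∧
      ∀ t ∈ Pc z, ∀ t' ∈ Pc z, (B (nb z t) (nb z t') ↔ sqNormInt (t - t') = 18)) ∧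
    (∀ n : ℕ, ∀ z ∈ S (n + 1), ∀ y, B z y → y ∈ S n) ∧
    (∀ n m : ℕ, ∀ x ∈ S n, ∀ y ∈ S m, B x y →
      ∀ (z z' : EuclideanSpace ℝ (Fin 3)) (t t' u u' : Fin 3 → ℤ),
        (t = 0 ∧ z = x ∨ t ∈ Pc x ∧ z = nb x t) → (t' = 0 ∧ z' = x ∨ t' ∈ Pc x ∧ z' = nb x t') →
        (u = 0 ∧ z = y ∨ u ∈ Pc y ∧ z = nb y u) → (u' = 0 ∧ z' = y ∨ u' ∈ Pc y ∧ z' = nb y u') →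
        sqNormInt (u - u') = sqNormInt (t - t')) ∧
    (∀ x y, B x y → B y x))

include hch


/-- The labelling of a chart is injective on its pattern. [folklore] -/
theorem nb_inj {n : ℕ} {x : (EuclideanSpace ℝ (Fin 3))} (hx : x ∈ S n) {t t' : Fin 3 → ℤ} (ht : t ∈ Pc x) (ht' : t' ∈ Pc x) (h : nb x t = nb x t') : t = t' :=
  nb_injOn hch hx ht ht' h

/-- **Lower reference of the I-step.**  For a valid frame in the admissible regime, the unique
lower-cap label `ℓ` touching `t₁` labels a common neighbour of `x` and `y = nb x t₁` whose label
at `y` lies in the LOWER cap of `Istep` (it is off the new hexagon — it is neither the label of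
`nb x t₂` nor that of `nb x (t₁ − t₂)` — and it is neither equal nor adjacent to the transported
upper reference). [folklore] -/
theorem Istep_lower {n : ℕ} {x : (EuclideanSpace ℝ (Fin 3))} (hx : x ∈ S (n + 1))
    {t₁ t₂ : Fin 3 → ℤ} {U : Finset (Fin 3 → ℤ)} (hU : IsFrame (Pc x) t₁ t₂ U)
    (hreg : Pc (nb x t₁) = fcc3Int ∨ Pc x = hcpInt ∨
      (-zlab Pc nb (nb x t₁) x ∈ Pc (nb x t₁) ∧ -zlab Pc nb (nb x t₁) (nb x t₂) ∈ Pc (nb x t₁))) :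
    ∃ ℓ ∈ lowerCap (Pc x) t₁ t₂ U, sqNormInt (ℓ - t₁) = 18 ∧
      (lowerCap (Pc x) t₁ t₂ U).filter (fun e => sqNormInt (e - t₁) = 18) = {ℓ} ∧
      (B (nb x t₁) (nb x ℓ)) ∧
      sqNormInt (zlab Pc nb (nb x t₁) (nb x ℓ) - zlab Pc nb (nb x t₁) x) = 18 ∧
      zlab Pc nb (nb x t₁) (nb x ℓ) ∈ lowerCap (Pc (nb x t₁)) (Istep Pc nb ⟨x, t₁, t₂, U⟩).t₁
        (Istep Pc nb ⟨x, t₁, t₂, U⟩).t₂ (Istep Pc nb ⟨x, t₁, t₂, U⟩).U := by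
  obtain ⟨hyS, hbxy, hwP, -, hvP, hvnb, hnw, hnv, hDwv, hκ, -, -, -, c₁, hc₁U, hc₁t, -, hbu,
    -, hUeq, -⟩ := Istep_spec hch hx hU hreg
  obtain ⟨h12, hhex, hUP, hoff, c, hcU, hform⟩ := hU
  have hPx := pattern_cases hch hx
  have hPy := pattern_cases hch hyS
  have ht₁ : t₁ ∈ Pc x := hhex (mem_hexLabels_iff.2 (Or.inl rfl))
  have ht₂ : t₂ ∈ Pc x := hhex (mem_hexLabels_iff.2 (Or.inr (Or.inl rfl)))
  have ht12 : t₁ - t₂ ∈ Pc x :=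
    hhex (mem_hexLabels_iff.2 (Or.inr (Or.inr (Or.inr (Or.inr (Or.inr rfl))))))
  have hcP : c ∈ Pc x := hUP hcU
  have hc : c ∉ hexLabels t₁ t₂ := hoff c hcU
  have key : ∃ ℓ ∈ lowerCap (Pc x) t₁ t₂ U, sqNormInt (ℓ - t₁) = 18 ∧
      (lowerCap (Pc x) t₁ t₂ U).filter (fun e => sqNormInt (e - t₁) = 18) = {ℓ} ∧
      ∀ e ∈ U, sqNormInt (e - t₁) = 18 → (sqNormInt (ℓ - e) ≠ 0 ∧ sqNormInt (ℓ - e) ≠ 18) := by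
    rcases hform with hE | hO
    · have hc1 : c - t₁ ∈ Pc x := hUP (by rw [hE]; simp)
      have hc2 : c - t₂ ∈ Pc x := hUP (by rw [hE]; simp)
      rw [hE]
      exact (lowerRef_evenCap (Pc x) hPx t₁ ht₁ t₂ ht₂ c hcP h12 hhex hc hc1 hc2).1
    · have hc1 : c + t₁ ∈ Pc x := hUP (by rw [hO]; simp)
      have hc2 : c + t₂ ∈ Pc x := hUP (by rw [hO]; simp)
      rw [hO]
      exact (lowerRef_oddCap (Pc x) hPx t₁ ht₁ t₂ ht₂ c hcP h12 hhex hc hc1 hc2).1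
  obtain ⟨ℓ, hℓL, hℓt, hfilt, hcross⟩ := key
  obtain ⟨hℓP, hℓhex, -⟩ := mem_lowerCap_iff.1 hℓL
  have hz := nb_mem hch hx hℓP
  have hbz : B (nb x t₁) (nb x ℓ) :=
    (bond_nb_iff hch hx ht₁ hℓP).2 (by rw [sqNormInt_sub_comm]; exact hℓt)
  have hlam := zlab_spec hch hyS hz.1 hbz
  -- distances at `y`
  have Dlamw : sqNormInt (zlab Pc nb (nb x t₁) (nb x ℓ) - zlab Pc nb (nb x t₁) x) = 18 := by
    rw [transfer_nb_centre hch hx hyS hbxy hℓP hbz]; exact chart_sqNormInt_eq hch hx hℓP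
  have Dlamμ : sqNormInt (zlab Pc nb (nb x t₁) (nb x ℓ) - zlab Pc nb (nb x t₁) (nb x c₁)) ≠ 0 ∧
      sqNormInt (zlab Pc nb (nb x t₁) (nb x ℓ) - zlab Pc nb (nb x t₁) (nb x c₁)) ≠ 18 := by
    rw [transfer_nb_nb hch hx hyS hbxy hℓP (hUP hc₁U) hbz hbu]; exact hcross c₁ hc₁U hc₁t
  -- off the new hexagon
  have hK : nb (nb x t₁) (zlab Pc nb (nb x t₁) x - zlab Pc nb (nb x t₁) (nb x t₂)) =
      nb x (t₁ - t₂) := by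
    rw [← hκ]
    exact (zlab_spec hch hyS (nb_mem hch hx ht12).1 ((bond_nb_iff hch hx ht₁ ht12).2
      (dist_hexagon (Pc x) hPx t₁ ht₁ t₂ ht₂ h12 hhex).2.2.2.2.2.1)).2
  have hnothex : zlab Pc nb (nb x t₁) (nb x ℓ) ∉
      hexLabels (Istep Pc nb ⟨x, t₁, t₂, U⟩).t₁ (Istep Pc nb ⟨x, t₁, t₂, U⟩).t₂ := by
    intro hmem
    rcases hex_touching_w_I (Pc (nb x t₁)) hPy _ hwP _ hvP hnw hnv hDwv _ hmem Dlamw with h | h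
    · have e1 : nb x ℓ = nb x t₂ := by rw [← hlam.2, h, hvnb]
      exact hℓhex (by rw [nb_inj hch hx hℓP ht₂ e1]; exact mem_hexLabels_iff.2 (Or.inr (Or.inl rfl)))
    · have e1 : nb x ℓ = nb x (t₁ - t₂) := by rw [← hlam.2, h, hK]
      exact hℓhex (by rw [nb_inj hch hx hℓP ht12 e1]; exact mem_hexLabels_iff.2 (Or.inr (Or.inr (Or.inr (Or.inr (Or.inr rfl))))))
  have hnotU : zlab Pc nb (nb x t₁) (nb x ℓ) ∉ (Istep Pc nb ⟨x, t₁, t₂, U⟩).U := by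
    rw [hUeq]; exact not_mem_capWithAny_singleton Dlamμ.1 Dlamμ.2
  exact ⟨ℓ, hℓL, hℓt, hfilt, hbz, Dlamw, mem_lowerCap_iff.2 ⟨hlam.1, hnothex, hnotU⟩⟩

/-- **Lower reference of the J-step** (the unique lower-cap label touching `t₂`). [folklore] -/
theorem Jstep_lower {n : ℕ} {x : (EuclideanSpace ℝ (Fin 3))} (hx : x ∈ S (n + 1))
    {t₁ t₂ : Fin 3 → ℤ} {U : Finset (Fin 3 → ℤ)} (hU : IsFrame (Pc x) t₁ t₂ U)
    (hreg : Pc (nb x t₂) = fcc3Int ∨ Pc x = hcpInt ∨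
      (-zlab Pc nb (nb x t₂) x ∈ Pc (nb x t₂) ∧ -zlab Pc nb (nb x t₂) (nb x t₁) ∈ Pc (nb x t₂))) :
    ∃ ℓ ∈ lowerCap (Pc x) t₁ t₂ U, sqNormInt (ℓ - t₂) = 18 ∧
      (lowerCap (Pc x) t₁ t₂ U).filter (fun e => sqNormInt (e - t₂) = 18) = {ℓ} ∧
      (B (nb x t₂) (nb x ℓ)) ∧
      sqNormInt (zlab Pc nb (nb x t₂) (nb x ℓ) - zlab Pc nb (nb x t₂) x) = 18 ∧
      zlab Pc nb (nb x t₂) (nb x ℓ) ∈ lowerCap (Pc (nb x t₂)) (Jstep Pc nb ⟨x, t₁, t₂, U⟩).t₁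
        (Jstep Pc nb ⟨x, t₁, t₂, U⟩).t₂ (Jstep Pc nb ⟨x, t₁, t₂, U⟩).U := by
  obtain ⟨hyS, hbxy, hwP, -, hvP, hvnb, hnw, hnv, hDwv, hκ, -, -, -, c₂, hc₂U, hc₂t, -, hbu,
    -, hUeq, -⟩ := Jstep_spec hch hx hU hreg
  obtain ⟨h12, hhex, hUP, hoff, c, hcU, hform⟩ := hU
  have hPx := pattern_cases hch hx
  have hPy := pattern_cases hch hyS
  have ht₁ : t₁ ∈ Pc x := hhex (mem_hexLabels_iff.2 (Or.inl rfl))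
  have ht₂ : t₂ ∈ Pc x := hhex (mem_hexLabels_iff.2 (Or.inr (Or.inl rfl)))
  have ht21 : t₂ - t₁ ∈ Pc x := hhex (mem_hexLabels_iff.2 (Or.inr (Or.inr (Or.inl rfl))))
  have hcP : c ∈ Pc x := hUP hcU
  have hc : c ∉ hexLabels t₁ t₂ := hoff c hcU
  have key : ∃ ℓ ∈ lowerCap (Pc x) t₁ t₂ U, sqNormInt (ℓ - t₂) = 18 ∧
      (lowerCap (Pc x) t₁ t₂ U).filter (fun e => sqNormInt (e - t₂) = 18) = {ℓ} ∧
      ∀ e ∈ U, sqNormInt (e - t₂) = 18 → (sqNormInt (ℓ - e) ≠ 0 ∧ sqNormInt (ℓ - e) ≠ 18) := by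
    rcases hform with hE | hO
    · have hc1 : c - t₁ ∈ Pc x := hUP (by rw [hE]; simp)
      have hc2 : c - t₂ ∈ Pc x := hUP (by rw [hE]; simp)
      rw [hE]
      exact (lowerRef_evenCap (Pc x) hPx t₁ ht₁ t₂ ht₂ c hcP h12 hhex hc hc1 hc2).2.1
    · have hc1 : c + t₁ ∈ Pc x := hUP (by rw [hO]; simp)
      have hc2 : c + t₂ ∈ Pc x := hUP (by rw [hO]; simp)
      rw [hO]
      exact (lowerRef_oddCap (Pc x) hPx t₁ ht₁ t₂ ht₂ c hcP h12 hhex hc hc1 hc2).2.1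
  obtain ⟨ℓ, hℓL, hℓt, hfilt, hcross⟩ := key
  obtain ⟨hℓP, hℓhex, -⟩ := mem_lowerCap_iff.1 hℓL
  have hz := nb_mem hch hx hℓP
  have hbz : B (nb x t₂) (nb x ℓ) :=
    (bond_nb_iff hch hx ht₂ hℓP).2 (by rw [sqNormInt_sub_comm]; exact hℓt)
  have hlam := zlab_spec hch hyS hz.1 hbz
  have Dlamw : sqNormInt (zlab Pc nb (nb x t₂) (nb x ℓ) - zlab Pc nb (nb x t₂) x) = 18 := by
    rw [transfer_nb_centre hch hx hyS hbxy hℓP hbz]; exact chart_sqNormInt_eq hch hx hℓP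
  have Dlamμ : sqNormInt (zlab Pc nb (nb x t₂) (nb x ℓ) - zlab Pc nb (nb x t₂) (nb x c₂)) ≠ 0 ∧
      sqNormInt (zlab Pc nb (nb x t₂) (nb x ℓ) - zlab Pc nb (nb x t₂) (nb x c₂)) ≠ 18 := by
    rw [transfer_nb_nb hch hx hyS hbxy hℓP (hUP hc₂U) hbz hbu]; exact hcross c₂ hc₂U hc₂t
  have hK : nb (nb x t₂) (zlab Pc nb (nb x t₂) x - zlab Pc nb (nb x t₂) (nb x t₁)) =
      nb x (t₂ - t₁) := by
    rw [← hκ]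
    refine (zlab_spec hch hyS (nb_mem hch hx ht21).1 ((bond_nb_iff hch hx ht₂ ht21).2 ?_)).2
    exact (dist_hexagon (Pc x) hPx t₁ ht₁ t₂ ht₂ h12 hhex).2.2.2.2.2.2.1
  have hnothex : zlab Pc nb (nb x t₂) (nb x ℓ) ∉
      hexLabels (Jstep Pc nb ⟨x, t₁, t₂, U⟩).t₁ (Jstep Pc nb ⟨x, t₁, t₂, U⟩).t₂ := by
    intro hmem
    rcases hex_touching_w_J (Pc (nb x t₂)) hPy _ hwP _ hvP hnw hnv hDwv _ hmem Dlamw with h | h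
    · have e1 : nb x ℓ = nb x t₁ := by rw [← hlam.2, h, hvnb]
      exact hℓhex (by rw [nb_inj hch hx hℓP ht₁ e1]; exact mem_hexLabels_iff.2 (Or.inl rfl))
    · have e1 : nb x ℓ = nb x (t₂ - t₁) := by rw [← hlam.2, h, hK]
      exact hℓhex (by rw [nb_inj hch hx hℓP ht21 e1]; exact mem_hexLabels_iff.2 (Or.inr (Or.inr (Or.inl rfl))))
  have hnotU : zlab Pc nb (nb x t₂) (nb x ℓ) ∉ (Jstep Pc nb ⟨x, t₁, t₂, U⟩).U := by
    rw [hUeq]; exact not_mem_capWithAny_singleton Dlamμ.1 Dlamμ.2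
  exact ⟨ℓ, hℓL, hℓt, hfilt, hbz, Dlamw, mem_lowerCap_iff.2 ⟨hlam.1, hnothex, hnotU⟩⟩

/-- **Lower reference of the I⁻¹-step** (the unique lower-cap label touching `−t₁`). [folklore] -/
theorem IinvStep_lower {n : ℕ} {x : (EuclideanSpace ℝ (Fin 3))}
    (hx : x ∈ S (n + 1)) {t₁ t₂ : Fin 3 → ℤ} {U : Finset (Fin 3 → ℤ)} (hU : IsFrame (Pc x) t₁ t₂ U)
    (hreg : Pc (nb x (-t₁)) = fcc3Int ∨ Pc x = hcpInt ∨
      (-zlab Pc nb (nb x (-t₁)) x ∈ Pc (nb x (-t₁)) ∧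
        -zlab Pc nb (nb x (-t₁)) (nb x (t₂ - t₁)) ∈ Pc (nb x (-t₁)))) :
    ∃ ℓ ∈ lowerCap (Pc x) t₁ t₂ U, sqNormInt (ℓ + t₁) = 18 ∧
      (lowerCap (Pc x) t₁ t₂ U).filter (fun e => sqNormInt (e + t₁) = 18) = {ℓ} ∧
      (B (nb x (-t₁)) (nb x ℓ)) ∧
      sqNormInt (zlab Pc nb (nb x (-t₁)) (nb x ℓ) - zlab Pc nb (nb x (-t₁)) x) = 18 ∧
      zlab Pc nb (nb x (-t₁)) (nb x ℓ) ∈ lowerCap (Pc (nb x (-t₁)))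
        (IinvStep Pc nb ⟨x, t₁, t₂, U⟩).t₁ (IinvStep Pc nb ⟨x, t₁, t₂, U⟩).t₂
        (IinvStep Pc nb ⟨x, t₁, t₂, U⟩).U := by
  obtain ⟨hyS, hbxy, hwP, -, hvP, hvnb, hnw, hnv, hDwv, hκ, -, -, -, cm, hcmU, hcmt, -, hbu,
    -, hUeq, -⟩ := IinvStep_spec hch hx hU hreg
  obtain ⟨h12, hhex, hUP, hoff, c, hcU, hform⟩ := hU
  have hPx := pattern_cases hch hx
  have hPy := pattern_cases hch hyS
  have ht₁ : t₁ ∈ Pc x := hhex (mem_hexLabels_iff.2 (Or.inl rfl))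
  have ht₂ : t₂ ∈ Pc x := hhex (mem_hexLabels_iff.2 (Or.inr (Or.inl rfl)))
  have ht21 : t₂ - t₁ ∈ Pc x := hhex (mem_hexLabels_iff.2 (Or.inr (Or.inr (Or.inl rfl))))
  have hnt₁ : -t₁ ∈ Pc x := hhex (mem_hexLabels_iff.2 (Or.inr (Or.inr (Or.inr (Or.inl rfl)))))
  have hnt₂ : -t₂ ∈ Pc x :=
    hhex (mem_hexLabels_iff.2 (Or.inr (Or.inr (Or.inr (Or.inr (Or.inl rfl))))))
  have hcP : c ∈ Pc x := hUP hcU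
  have hc : c ∉ hexLabels t₁ t₂ := hoff c hcU
  have key : ∃ ℓ ∈ lowerCap (Pc x) t₁ t₂ U, sqNormInt (ℓ + t₁) = 18 ∧
      (lowerCap (Pc x) t₁ t₂ U).filter (fun e => sqNormInt (e + t₁) = 18) = {ℓ} ∧
      ∀ e ∈ U, sqNormInt (e + t₁) = 18 → (sqNormInt (ℓ - e) ≠ 0 ∧ sqNormInt (ℓ - e) ≠ 18) := by
    rcases hform with hE | hO
    · have hc1 : c - t₁ ∈ Pc x := hUP (by rw [hE]; simp)
      have hc2 : c - t₂ ∈ Pc x := hUP (by rw [hE]; simp)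
      rw [hE]
      exact (lowerRef_evenCap (Pc x) hPx t₁ ht₁ t₂ ht₂ c hcP h12 hhex hc hc1 hc2).2.2.1
    · have hc1 : c + t₁ ∈ Pc x := hUP (by rw [hO]; simp)
      have hc2 : c + t₂ ∈ Pc x := hUP (by rw [hO]; simp)
      rw [hO]
      exact (lowerRef_oddCap (Pc x) hPx t₁ ht₁ t₂ ht₂ c hcP h12 hhex hc hc1 hc2).2.2.1
  obtain ⟨ℓ, hℓL, hℓt, hfilt, hcross⟩ := key
  obtain ⟨hℓP, hℓhex, -⟩ := mem_lowerCap_iff.1 hℓL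
  have hz := nb_mem hch hx hℓP
  have hbz : B (nb x (-t₁)) (nb x ℓ) :=
    (bond_nb_iff hch hx hnt₁ hℓP).2 (by
      rw [show -t₁ - ℓ = -(ℓ + t₁) by abel, sqNormInt_neg]; exact hℓt)
  have hlam := zlab_spec hch hyS hz.1 hbz
  have Dlamw : sqNormInt (zlab Pc nb (nb x (-t₁)) (nb x ℓ) - zlab Pc nb (nb x (-t₁)) x) = 18 := by
    rw [transfer_nb_centre hch hx hyS hbxy hℓP hbz]; exact chart_sqNormInt_eq hch hx hℓP
  have Dlamμ : sqNormInt (zlab Pc nb (nb x (-t₁)) (nb x ℓ) - zlab Pc nb (nb x (-t₁)) (nb x cm)) ≠ 0 ∧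
      sqNormInt (zlab Pc nb (nb x (-t₁)) (nb x ℓ) - zlab Pc nb (nb x (-t₁)) (nb x cm)) ≠ 18 := by
    rw [transfer_nb_nb hch hx hyS hbxy hℓP (hUP hcmU) hbz hbu]; exact hcross cm hcmU hcmt
  have hK : nb (nb x (-t₁)) (zlab Pc nb (nb x (-t₁)) x - zlab Pc nb (nb x (-t₁)) (nb x (t₂ - t₁))) =
      nb x (-t₂) := by
    rw [← hκ]
    refine (zlab_spec hch hyS (nb_mem hch hx hnt₂).1 ((bond_nb_iff hch hx hnt₁ hnt₂).2 ?_)).2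
    rw [show -t₁ - -t₂ = t₂ - t₁ by abel, sqNormInt_sub_comm]; exact h12
  have hnothex : zlab Pc nb (nb x (-t₁)) (nb x ℓ) ∉
      hexLabels (IinvStep Pc nb ⟨x, t₁, t₂, U⟩).t₁ (IinvStep Pc nb ⟨x, t₁, t₂, U⟩).t₂ := by
    intro hmem
    rcases hex_touching_w_Iinv (Pc (nb x (-t₁))) hPy _ hwP _ hvP hnw hnv hDwv _ hmem Dlamw
      with h | h
    · have e1 : nb x ℓ = nb x (t₂ - t₁) := by rw [← hlam.2, h, hvnb]
      exact hℓhex (by rw [nb_inj hch hx hℓP ht21 e1]; exact mem_hexLabels_iff.2 (Or.inr (Or.inr (Or.inl rfl))))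
    · have e1 : nb x ℓ = nb x (-t₂) := by rw [← hlam.2, h, hK]
      exact hℓhex (by rw [nb_inj hch hx hℓP hnt₂ e1]; exact mem_hexLabels_iff.2 (Or.inr (Or.inr (Or.inr (Or.inr (Or.inl rfl))))))
  have hnotU : zlab Pc nb (nb x (-t₁)) (nb x ℓ) ∉ (IinvStep Pc nb ⟨x, t₁, t₂, U⟩).U := by
    rw [hUeq]; exact not_mem_capWithAny_singleton Dlamμ.1 Dlamμ.2
  exact ⟨ℓ, hℓL, hℓt, hfilt, hbz, Dlamw, mem_lowerCap_iff.2 ⟨hlam.1, hnothex, hnotU⟩⟩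

/-- **Lower reference of the J⁻¹-step** (the unique lower-cap label touching `−t₂`). [folklore] -/
theorem JinvStep_lower {n : ℕ} {x : (EuclideanSpace ℝ (Fin 3))}
    (hx : x ∈ S (n + 1)) {t₁ t₂ : Fin 3 → ℤ} {U : Finset (Fin 3 → ℤ)} (hU : IsFrame (Pc x) t₁ t₂ U)
    (hreg : Pc (nb x (-t₂)) = fcc3Int ∨ Pc x = hcpInt ∨
      (-zlab Pc nb (nb x (-t₂)) x ∈ Pc (nb x (-t₂)) ∧
        -zlab Pc nb (nb x (-t₂)) (nb x (t₁ - t₂)) ∈ Pc (nb x (-t₂)))) :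
    ∃ ℓ ∈ lowerCap (Pc x) t₁ t₂ U, sqNormInt (ℓ + t₂) = 18 ∧
      (lowerCap (Pc x) t₁ t₂ U).filter (fun e => sqNormInt (e + t₂) = 18) = {ℓ} ∧
      (B (nb x (-t₂)) (nb x ℓ)) ∧
      sqNormInt (zlab Pc nb (nb x (-t₂)) (nb x ℓ) - zlab Pc nb (nb x (-t₂)) x) = 18 ∧
      zlab Pc nb (nb x (-t₂)) (nb x ℓ) ∈ lowerCap (Pc (nb x (-t₂)))
        (JinvStep Pc nb ⟨x, t₁, t₂, U⟩).t₁ (JinvStep Pc nb ⟨x, t₁, t₂, U⟩).t₂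
        (JinvStep Pc nb ⟨x, t₁, t₂, U⟩).U := by
  obtain ⟨hyS, hbxy, hwP, -, hvP, hvnb, hnw, hnv, hDwv, hκ, -, -, -, cm, hcmU, hcmt, -, hbu,
    -, hUeq, -⟩ := JinvStep_spec hch hx hU hreg
  obtain ⟨h12, hhex, hUP, hoff, c, hcU, hform⟩ := hU
  have hPx := pattern_cases hch hx
  have hPy := pattern_cases hch hyS
  have ht₁ : t₁ ∈ Pc x := hhex (mem_hexLabels_iff.2 (Or.inl rfl))
  have ht₂ : t₂ ∈ Pc x := hhex (mem_hexLabels_iff.2 (Or.inr (Or.inl rfl)))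
  have ht12 : t₁ - t₂ ∈ Pc x :=
    hhex (mem_hexLabels_iff.2 (Or.inr (Or.inr (Or.inr (Or.inr (Or.inr rfl))))))
  have hnt₁ : -t₁ ∈ Pc x := hhex (mem_hexLabels_iff.2 (Or.inr (Or.inr (Or.inr (Or.inl rfl)))))
  have hnt₂ : -t₂ ∈ Pc x :=
    hhex (mem_hexLabels_iff.2 (Or.inr (Or.inr (Or.inr (Or.inr (Or.inl rfl))))))
  have hcP : c ∈ Pc x := hUP hcU
  have hc : c ∉ hexLabels t₁ t₂ := hoff c hcU
  have key : ∃ ℓ ∈ lowerCap (Pc x) t₁ t₂ U, sqNormInt (ℓ + t₂) = 18 ∧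
      (lowerCap (Pc x) t₁ t₂ U).filter (fun e => sqNormInt (e + t₂) = 18) = {ℓ} ∧
      ∀ e ∈ U, sqNormInt (e + t₂) = 18 → (sqNormInt (ℓ - e) ≠ 0 ∧ sqNormInt (ℓ - e) ≠ 18) := by
    rcases hform with hE | hO
    · have hc1 : c - t₁ ∈ Pc x := hUP (by rw [hE]; simp)
      have hc2 : c - t₂ ∈ Pc x := hUP (by rw [hE]; simp)
      rw [hE]
      exact (lowerRef_evenCap (Pc x) hPx t₁ ht₁ t₂ ht₂ c hcP h12 hhex hc hc1 hc2).2.2.2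
    · have hc1 : c + t₁ ∈ Pc x := hUP (by rw [hO]; simp)
      have hc2 : c + t₂ ∈ Pc x := hUP (by rw [hO]; simp)
      rw [hO]
      exact (lowerRef_oddCap (Pc x) hPx t₁ ht₁ t₂ ht₂ c hcP h12 hhex hc hc1 hc2).2.2.2
  obtain ⟨ℓ, hℓL, hℓt, hfilt, hcross⟩ := key
  obtain ⟨hℓP, hℓhex, -⟩ := mem_lowerCap_iff.1 hℓL
  have hz := nb_mem hch hx hℓP
  have hbz : B (nb x (-t₂)) (nb x ℓ) :=
    (bond_nb_iff hch hx hnt₂ hℓP).2 (by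
      rw [show -t₂ - ℓ = -(ℓ + t₂) by abel, sqNormInt_neg]; exact hℓt)
  have hlam := zlab_spec hch hyS hz.1 hbz
  have Dlamw : sqNormInt (zlab Pc nb (nb x (-t₂)) (nb x ℓ) - zlab Pc nb (nb x (-t₂)) x) = 18 := by
    rw [transfer_nb_centre hch hx hyS hbxy hℓP hbz]; exact chart_sqNormInt_eq hch hx hℓP
  have Dlamμ : sqNormInt (zlab Pc nb (nb x (-t₂)) (nb x ℓ) - zlab Pc nb (nb x (-t₂)) (nb x cm)) ≠ 0 ∧
      sqNormInt (zlab Pc nb (nb x (-t₂)) (nb x ℓ) - zlab Pc nb (nb x (-t₂)) (nb x cm)) ≠ 18 := by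
    rw [transfer_nb_nb hch hx hyS hbxy hℓP (hUP hcmU) hbz hbu]; exact hcross cm hcmU hcmt
  have hK : nb (nb x (-t₂)) (zlab Pc nb (nb x (-t₂)) x - zlab Pc nb (nb x (-t₂)) (nb x (t₁ - t₂))) =
      nb x (-t₁) := by
    rw [← hκ]
    refine (zlab_spec hch hyS (nb_mem hch hx hnt₁).1 ((bond_nb_iff hch hx hnt₂ hnt₁).2 ?_)).2
    rw [show -t₂ - -t₁ = t₁ - t₂ by abel]; exact h12
  have hnothex : zlab Pc nb (nb x (-t₂)) (nb x ℓ) ∉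
      hexLabels (JinvStep Pc nb ⟨x, t₁, t₂, U⟩).t₁ (JinvStep Pc nb ⟨x, t₁, t₂, U⟩).t₂ := by
    intro hmem
    rcases hex_touching_w_Jinv (Pc (nb x (-t₂))) hPy _ hwP _ hvP hnw hnv hDwv _ hmem Dlamw
      with h | h
    · have e1 : nb x ℓ = nb x (t₁ - t₂) := by rw [← hlam.2, h, hvnb]
      exact hℓhex (by rw [nb_inj hch hx hℓP ht12 e1]; exact mem_hexLabels_iff.2 (Or.inr (Or.inr (Or.inr (Or.inr (Or.inr rfl))))))
    · have e1 : nb x ℓ = nb x (-t₁) := by rw [← hlam.2, h, hK]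
      exact hℓhex (by rw [nb_inj hch hx hℓP hnt₁ e1]; exact mem_hexLabels_iff.2 (Or.inr (Or.inr (Or.inr (Or.inl rfl)))))
  have hnotU : zlab Pc nb (nb x (-t₂)) (nb x ℓ) ∉ (JinvStep Pc nb ⟨x, t₁, t₂, U⟩).U := by
    rw [hUeq]; exact not_mem_capWithAny_singleton Dlamμ.1 Dlamμ.2
  exact ⟨ℓ, hℓL, hℓt, hfilt, hbz, Dlamw, mem_lowerCap_iff.2 ⟨hlam.1, hnothex, hnotU⟩⟩

omit hch in
/-! ## Registered anchor (closed form) -/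

omit hch in
/-- **Closed form of `nb_inj`** (the registered anchor of this file): the section data
`S, B, Pc, nb` and the standing hypothesis written out (two hypotheses regrouped). [folklore] -/
theorem nb_inj_graded :
    ∀ {S : ℕ → Set (EuclideanSpace ℝ (Fin 3))} {B : EuclideanSpace ℝ (Fin 3) → EuclideanSpace ℝ
    (Fin 3) → Prop} {Pc : EuclideanSpace ℝ (Fin 3) → Finset (Fin 3 → ℤ)} {nb : EuclideanSpace ℝ
    (Fin 3) → (Fin 3 → ℤ) → EuclideanSpace ℝ (Fin 3)}, ((∀ n : ℕ, ∀ z ∈ S n, (Pc z =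
    Summit.AtomisticToContinuum.Crystallization.Theorems.PalmUnimodularRigidityShellsToBarlowChart.fcc3Int
    ∨ Pc z = Literature.Geometry.DiscreteGeometry.hcpInt) ∧ Set.BijOn (nb z) (↑(Pc z) : Set (Fin
    3 → ℤ)) {y | B z y} ∧ ∀ t ∈ Pc z, ∀ t' ∈ Pc z, (B (nb z t) (nb z t') ↔
    Literature.Geometry.DiscreteGeometry.sqNormInt (t - t') = 18)) ∧ (∀ n : ℕ, ∀ z ∈ S (n + 1),
    ∀ y, B z y → y ∈ S n) ∧ (∀ n m : ℕ, ∀ x ∈ S n, ∀ y ∈ S m, B x y → ∀ (z z' : EuclideanSpace ℝ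
    (Fin 3)) (t t' u u' : Fin 3 → ℤ), (t = 0 ∧ z = x ∨ t ∈ Pc x ∧ z = nb x t) → (t' = 0 ∧ z' = x
    ∨ t' ∈ Pc x ∧ z' = nb x t') → (u = 0 ∧ z = y ∨ u ∈ Pc y ∧ z = nb y u) → (u' = 0 ∧ z' = y ∨
    u' ∈ Pc y ∧ z' = nb y u') → Literature.Geometry.DiscreteGeometry.sqNormInt (u - u') =
    Literature.Geometry.DiscreteGeometry.sqNormInt (t - t')) ∧ (∀ x y, B x y → B y x)) → ∀ {n :
    ℕ} {x : (EuclideanSpace ℝ (Fin 3))} {t t' : Fin 3 → ℤ}, t ∈ Pc x → x ∈ S n → t' ∈ Pc x → nb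
    x t = nb x t' → t = t' := by
  intro S B Pc nb hch n x t t' ht hx ht' h
  exact nb_inj hch hx ht ht' h

end Summit.AtomisticToContinuum.Crystallization.Theorems.SquareWellLayerCakeGapTwelveToBarlow

end
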